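import Literature.MathematicalPhysics.QuantumFieldTheory.Balaban1983to89.B1Ineq225ZeroFieldTorusLevels

/-!
# `Balaban1983to89.B1Ineq225DerivZeroFieldTorus` — T. Bałaban, *(Higgs)₂,₃ quantum fields in a finite volume. I. A lower bound*,
# Commun. Math. Phys. **85** (1982) 603–626 [Balaban1982Higgs1]: Prop. 2.1 (2.25), THE DERIVATIVE CLAUSE WITH ITS DECAY FACTOR —
# `|(D^ε_{A,μ}G^ε_k(T_ε,0)f)(b)| ≦ c₀(L^kε) exp(−δ₀(L^kε)^{−1}dist(b₋, supp f))‖f‖_∞` — PROVED FOR THE (Higgs)₂,₃ MODEL AT ZERO FIELD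
# AT EVERY LEVEL `1 ≦ k ≦ K`, every coupling, every `N`, with ONE pair `δ₀, c₀` for all volumes of the torus sub-family `M·L′_μ = L^m`,
# all levels and all `L^kε ≦ ε₀` (from the derivative clause of B4's Theorem (1.10) on the torus, p38's `B4Thm110ZeroTorus.deriv_row_bound`)

statement-level skeleton of published theorems with citation tags; proofs where landed; nothing here is a claim about the Yang–Mills mass gap

PDF held: `paper:balaban1982-cmp85-higgs23-i` (journal page = PDF page + 602); p. 604 [PDF 2] ((1.3)–(1.4)), p. 605 [PDF 3] ((1.7)),
p. 610 [PDF 8] (Prop. 2.1 (2.24)–(2.25), (2.20), (2.22)); ×2 renders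
`run/shared/lean/pub/pub-balaban/b2b-balaban-ref1/pages/1982-cmp85-higgs23-I/1982-cmp85-higgs23-I-p002|p003|p008-x2.png`; B4 =
[Balaban1983RegularityDecay] p. 573 [PDF 3] (Theorem (1.10)), held `paper:balaban1983-cmp89-regularity-decay`.

CITATION HEADER (lean-in-tree rule).  Cell `lit-balaban` (HOME `run/shared/lean/pub/lit-balaban/`), Phase-2 proof seat **p14** gen 9 (unit
`lit-balaban-p14`), companion of `B1Ineq225ZeroFieldTorusLevels` (value clause); SKELETON row **B1.Prop2.1** ((2.25) derivative clause,
`A = 0`, torus, every level: MODEL INSTANCE on the (Higgs)₂,₃ carrier).  USED BY NAME, never restated: p38's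
`B4Thm110ZeroTorus.{deriv_row_bound, kerBounds_torus, cTerm}`, gen 8's `B1Ineq225ZeroFieldTorus.{G0unit_decay_cap, norm_le_sqrt_mul}`,
`B5Leaf237C0Torus.{gamma0, dK0}`, `B5Ineq137Torus.T`, `B1RG242Torus.{deriv, deriv_mulVec}`, this seat's `B1Eq211ZeroFieldTorusLevels.{setupAt,
eSiteAt, eSiteAt_shift, cmpAt, mesh_zero_eq_at}`, `B1Eq220ZeroFieldTorusLevels.{propagatorK_zero_apply_at, T_eq_tdist_symm}`,
`B1Ineq225ZeroFieldTorusLevels.{abs_cmpAt_le, eps_setupAt_mul}`, the typer's `HiggsLattice.{covDeriv, sderiv, covDeriv_zero, Site.tdist}`,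
`HiggsCovariance.propagatorK`.

WHAT IS PRINTED (verbatim).  p. 605 [PDF 3], (1.7): *"(D^ε_Aφ)(b) = ε^{−1}(U(A_b)φ(b₊) − φ(b₋))"*; p. 610 [PDF 8], Prop. 2.1: *"there exist
constants δ₀ > 0, c₀, such that … |(D^ε_{A,μ}G^ε_k(Ω,A)f)(x)|, … ≦ c₀ … exp(−δ₀(L^kε)^{−1} dist(x, supp f)) sup_x|f(x)| … (2.25)"* ⟦the
display is partly illegible on the held scan; after the rescaling (2.22) it is B4's (1.10), whose derivative clause carries one power of
`L^kε` less than the value clause⟧; B4 p. 573 [PDF 3], Theorem: *"Similarly |(D^η_{A,μ}G_k(Ω, A)f)(x)|, |(G_k(Ω, A)f)(x)| ≦ c₀ exp(−δ₀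
dist(x, supp f))‖f‖_∞ (1.10)"*.

WHAT THIS FILE PROVES (kernel-checked, zero `sorry`, theorems only; axioms standard).
* §1 **B4 (1.10) ON THE TORUS, DERIVATIVE CLAUSE WITH DECAY, TOP LEVEL, UNIFORM UNDER A MASS CAP**: `torus_deriv_decay_bound` — ONE `δ₀, c₀ > 0`
  with `|(∂^ε_μG_Kf)(x)| ≦ c₀e^{−δ₀εD}F` for every volume `(m, K ≧ 1)` of Bałaban's scalar torus tower, every mass `0 ≦ m² ≦ m₊²`, every
  direction, every `f` with `|f| ≦ F` vanishing within fine sup-distance `D ≧ 0` of `x` (p38's `deriv_row_bound` + `kerBounds_torus` + gen 8's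
  `G0unit_decay_cap`).
* §2 the dictionary: `sderiv_propagatorK_apply_at` — `(∂^ε(G^ε_k(T_ε,0)g))(⟨x, x+εe_μ⟩)_i = (L^kε)·((∂^{η}_μG_k) cmp_i g)(e x)` on the level-`k`
  torus (`η = L^{−k}`, `ε = (L^kε)η`), and `covDeriv_zero` (the typer's: at `A = 0`, `D^ε_A = ∂^ε` for every coupling).
* §3 **(2.25), DERIVATIVE CLAUSE, FOR THE MODEL AT `A = 0`, EVERY LEVEL**: `covDeriv_propagatorK_decay_bound` — for `d ≧ 1`, odd `L > 1`,
  `a > 0`, `m² ≧ 0`, `ε₀`, `N`: `δ₀, c₀ > 0` with `‖(D^ε_{0}G^ε_k(T_ε,0)g)(b)‖ ≦ c₀(L^kε)e^{−δ₀D/L^k}M` on every torus of the sub-family, every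
  coupling, every `1 ≦ k ≦ K` with `L^kε ≦ ε₀`, every bond `b = ⟨x, x+εe_μ⟩` and every `g` with `‖g‖ ≦ M` vanishing within (1.3)-distance `D`
  of `x`; `covDeriv_propagatorK_sup_bound` (the case `D = 0`: `‖D^εG^ε_kg‖_∞ ≦ c₀(L^kε)‖g‖_∞`).
HONEST SCOPE: `A = 0` (hence any coupling), `Ω = T_ε`, tori with `M·L′_μ = L^m` and `L` odd, levels `1 ≦ k ≦ K`; constants existential
(functions of `d, L, a, m²ε₀², N`); distance = sup torus distance (1.3) in lattice units from the initial point `b₋` of the bond; the Hölder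
clause (2.24) is not transported here; background fields `A ≠ 0` are NOT covered.  Unit `lit-balaban-p14` gen 9
(literature-prover-lit-balaban-p14-g9-0).
-/

open scoped BigOperators
open Matrix

namespace Literature.MathematicalPhysics.QuantumFieldTheory.Balaban1983to89.B1Ineq225DerivZeroFieldTorus

open Literature.MathematicalPhysics.QuantumFieldTheory.Balaban1983to89.HiggsLattice (ChargeData covDeriv sderiv covDeriv_zero)
open Literature.MathematicalPhysics.QuantumFieldTheory.Balaban1983to89.HiggsCovariance (propagatorK)
open Literature.MathematicalPhysics.QuantumFieldTheory.Balaban1983to89.B1RG242Torus (tower deriv deriv_mulVec)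
open Literature.MathematicalPhysics.QuantumFieldTheory.Balaban1983to89.B5Display136Torus (G0unit)
open Literature.MathematicalPhysics.QuantumFieldTheory.Balaban1983to89.B5Ineq137Torus (T T_nonneg)
open Literature.MathematicalPhysics.QuantumFieldTheory.Balaban1983to89.B5Leaf237C0Torus (gamma0 dK0 gamma0_pos dK0_pos)
open Literature.MathematicalPhysics.QuantumFieldTheory.Balaban1983to89.B4Thm110ZeroTorus (KerBounds cTerm cTerm_nonneg
  deriv_row_bound kerBounds_torus)
open Literature.MathematicalPhysics.QuantumFieldTheory.Balaban1983to89.B1Eq211ZeroFieldTorus (Shape)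
open Literature.MathematicalPhysics.QuantumFieldTheory.Balaban1983to89.B1Ineq225ZeroFieldTorus (G0unit_decay_cap norm_le_sqrt_mul)
open Literature.MathematicalPhysics.QuantumFieldTheory.Balaban1983to89.B1Eq211ZeroFieldTorusLevels (setupAt setupAt_d setupAt_L
  eSiteAt eSiteAt_shift cmpAt cmpAt_apply mesh_zero_eq_at)
open Literature.MathematicalPhysics.QuantumFieldTheory.Balaban1983to89.B1Eq220ZeroFieldTorusLevels (propagatorK_zero_apply_at
  T_eq_tdist_symm)
open Literature.MathematicalPhysics.QuantumFieldTheory.Balaban1983to89.B1Ineq225ZeroFieldTorusLevels (abs_cmpAt_le eps_setupAt_mul)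

variable {P : HiggsLattice.Params}

/-! ## §1 B4 (1.10) on the torus: the derivative clause with its decay factor, top level, uniform under a mass cap -/

section Torus

/-- **B4 THEOREM (1.10) ON THE TORUS, DERIVATIVE CLAUSE WITH DECAY, TOP LEVEL, UNIFORM**: for `d ≧ 1`, odd `L > 1`, `a > 0` and a mass cap
`m₊² ≧ 0` there are `δ₀, c₀ > 0` with `|(∂^ε_μG_Kf)(x)| ≦ c₀e^{−δ₀·εD}·F` for every volume `(m, K)` of Bałaban's scalar torus tower with
`K ≧ 1` (top level = unit lattice, `ε = L^{−K}`), every mass `0 ≦ m² ≦ m₊²`, every direction `μ`, every site `x` and every `f` with `|f| ≦ F`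
vanishing within fine sup-distance `D ≧ 0` of `x` — p38's `deriv_row_bound` with `kerBounds_torus` and gen 8's `G0unit_decay_cap`.
[cite: Balaban1983RegularityDecay, Theorem (1.10) p.573; (2.38)–(2.39) p.582] -/
theorem torus_deriv_decay_bound (d L : ℕ) (hd : 1 ≤ d) (hL : Odd L ∧ 1 < L) {a : ℝ} (ha : 0 < a) {m2plus : ℝ}
    (hm2 : 0 ≤ m2plus) :
    ∃ δ₀ c₀ : ℝ, 0 < δ₀ ∧ 0 < c₀ ∧ ∀ (Q : Params), Q.d = d → Q.L = L → 1 ≤ Q.K → ∀ (msq : ℝ), 0 ≤ msq → msq ≤ m2plus →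
      ∀ (μ : Fin Q.d) (x : Site Q 0) (f : Site Q 0 → ℝ) (F D : ℝ), (∀ z, |f z| ≤ F) → 0 ≤ D →
        (∀ z, f z ≠ 0 → D ≤ T Q 0 x z) →
          |((deriv Q 0 Q.eps μ * (tower Q a msq).G Q.K) *ᵥ f) x| ≤ c₀ * Real.exp (-(δ₀ * (Q.eps * D))) * F := by
  obtain ⟨C, δ, hC, hδ, hKB⟩ := kerBounds_torus d L hd hL ha m2plus
  obtain ⟨P₀, hP₀d, hP₀L⟩ : ∃ P₀ : Params, P₀.d = d ∧ P₀.L = L := ⟨⟨d, L, 0, 0, hd, hL⟩, rfl, rfl⟩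
  have hγ : 0 < gamma0 L a := by rw [← hP₀L]; exact gamma0_pos (P := P₀) ha
  have hδK : 0 < dK0 d L a m2plus := by rw [← hP₀d, ← hP₀L]; exact dK0_pos (P := P₀) ha hm2
  have hL1 : (1 : ℝ) < L := by exact_mod_cast hL.2
  have h1 := B4Sect5Proof.latticeConst_nonneg d (show 0 ≤ dK0 d L a m2plus / 2 by positivity)
  have h2 := cTerm_nonneg d hC hδ
  have h3 : 0 ≤ 1 / ((L : ℝ) - 1) := div_nonneg zero_le_one (by linarith)
  have hC₀ : 0 ≤ 2 / gamma0 L a := (div_pos two_pos hγ).le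
  have hE : 0 ≤ Real.exp (dK0 d L a m2plus) := Real.exp_nonneg _
  refine ⟨min (dK0 d L a m2plus / 2) (δ / 4),
    2 * (2 / gamma0 L a) * Real.exp (dK0 d L a m2plus) * B4Sect5Proof.latticeConst d (dK0 d L a m2plus / 2)
      + a ^ 2 * cTerm d C δ * (1 / ((L : ℝ) - 1)) + 1,
    lt_min (by positivity) (by positivity), by positivity, ?_⟩
  intro Q hQd hQL hK1 msq hmsq hcap μ x f F D hF hD0 hD
  have hkm : Q.K ≤ Q.m + Q.K := Nat.le_add_left _ _
  have hcapK : Q.spacing Q.K ^ 2 * msq ≤ m2plus := by rw [Q.spacing_K, one_pow, one_mul]; exact hcap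
  have hKB' : KerBounds Q a msq Q.K C δ := hKB Q hQd hQL msq hmsq Q.K hkm hcapK
  subst hQd hQL
  have hG0 : ∀ y y' : Site Q 0, |G0unit Q a msq y y'| ≤ 2 / gamma0 Q.L a * Real.exp (-(dK0 Q.d Q.L a m2plus * T Q 0 y y')) :=
    fun y y' => G0unit_decay_cap ha hmsq hcap y y'
  have hF0 : 0 ≤ F := (abs_nonneg _).trans (hF x)
  have h := deriv_row_bound Q ha hmsq hK1 le_rfl hkm hC hδ hC₀ hδK hKB' hG0 μ x f hF hD0 hD
  refine h.trans (mul_le_mul_of_nonneg_right (mul_le_mul_of_nonneg_right ?_ (Real.exp_nonneg _)) hF0)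
  linarith

end Torus

/-! ## §2 The dictionary: the difference derivative of `G^ε_k(T_ε,0)g` on the level-`k` torus -/

section Dictionary

variable (S : Shape P) {k : ℕ} (hk : k ≤ P.K) {N : ℕ} (C : ChargeData N) {msq a : ℝ}

/-- **`∂^ε(G^ε_kg)` READ ON THE LEVEL-`k` TORUS**: for the bond `⟨x, x + εe_μ⟩`, the `i`-th component of `(∂^ε(G^ε_k(T_ε,0)g))(b) =
ε^{−1}((G^ε_kg)(x+εe_μ) − (G^ε_kg)(x))` is `(L^kε)·((∂^{η}_μG_k) cmp_i g)(e x)`, `∂^{η}_μ = B1RG242Torus.deriv (setupAt S k) 0 η μ`,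
`η = L^{−k}` (`ε = (L^kε)η`; one power of `L^kε` survives, as in (2.25)). [cite: Balaban1982Higgs1, (1.4) p.604; (2.22) p.610] -/
theorem sderiv_propagatorK_apply_at (hk1 : 1 ≤ k) (ha : 0 < a) (hmsq : 0 ≤ msq) (g : HiggsLattice.ScalarField P 0 N)
    (x : HiggsLattice.Site P 0) (μ : Fin P.d) (i : Fin N) :
    (sderiv (propagatorK C Finset.univ (0 : HiggsLattice.VecField P 0) msq a k g) ⟨x, μ⟩) i
      = P.mesh k * ((deriv (setupAt S k) 0 (setupAt S k).eps μ * (tower (setupAt S k) a (msq * P.mesh k ^ 2)).G k)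
          *ᵥ cmpAt S hk i g) (eSiteAt S hk (Nat.zero_le _) x) := by
  have hℓ : P.mesh k ≠ 0 := (P.mesh_pos k).ne'
  have hη : (setupAt S k).eps ≠ 0 := (setupAt S k).eps_pos.ne'
  have h0 : P.mesh 0 = P.mesh k * (setupAt S k).eps := mesh_zero_eq_at S k
  have hA := propagatorK_zero_apply_at S hk C hk1 ha hmsq g (x.shift μ) i
  have hB := propagatorK_zero_apply_at S hk C hk1 ha hmsq g x i
  show ((P.mesh 0)⁻¹ • (propagatorK C Finset.univ (0 : HiggsLattice.VecField P 0) msq a k g (x.shift μ)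
      - propagatorK C Finset.univ (0 : HiggsLattice.VecField P 0) msq a k g x)) i = _
  rw [PiLp.smul_apply, PiLp.sub_apply, smul_eq_mul, hA, hB, ← Matrix.mulVec_mulVec, deriv_mulVec, ← eSiteAt_shift, h0,
    mul_inv]
  field_simp

end Dictionary

/-! ## §3 (2.25), derivative clause, for the model's propagator at `A = 0`, every level, every coupling -/

section Model

/-- **PROP. 2.1 (2.25), DERIVATIVE CLAUSE WITH ITS DECAY FACTOR, FOR THE (Higgs)₂,₃ MODEL AT `A = 0`, EVERY LEVEL — PROVED, UNIFORMLY**: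
for `d ≧ 1`, odd `L > 1`, `a > 0`, `m² ≧ 0`, any `ε₀` and `N` there are `δ₀, c₀ > 0` such that on every torus `T_ε` of the sub-family
`M·L′_μ = L^m`, for every coupling `C`, every `1 ≦ k ≦ K` with `L^kε ≦ ε₀`, every bond `⟨x, x + εe_μ⟩` and every `g : T_ε → ℝ^N` with `‖g‖ ≦ M`
vanishing within (1.3)-distance `D ≧ 0` of `x`: `‖(D^ε_0 G^ε_k(T_ε,0)g)(⟨x, x+εe_μ⟩)‖ ≦ c₀(L^kε)e^{−δ₀D/L^k}M` (`D^ε_0 = ∂^ε` at `A = 0`,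
`covDeriv_zero`). [cite: Balaban1982Higgs1, Prop. 2.1 (2.25) p.610; (1.7) p.605] -/
theorem covDeriv_propagatorK_decay_bound (d L N : ℕ) (hd : 1 ≤ d) (hL : Odd L ∧ 1 < L) {a : ℝ} (ha : 0 < a) {msq : ℝ}
    (hmsq : 0 ≤ msq) (ε₀ : ℝ) :
    ∃ δ₀ c₀ : ℝ, 0 < δ₀ ∧ 0 < c₀ ∧ ∀ (P : HiggsLattice.Params) (S : Shape P), P.d = d → P.L = L →
      ∀ (C : ChargeData N) {k : ℕ}, 1 ≤ k → k ≤ P.K → P.mesh k ≤ ε₀ →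
        ∀ (g : HiggsLattice.ScalarField P 0 N) (M D : ℝ), (∀ x, ‖g x‖ ≤ M) → 0 ≤ D →
          ∀ (x : HiggsLattice.Site P 0) (μ : Fin P.d), (∀ z, g z ≠ 0 → D ≤ (HiggsLattice.Site.tdist x z : ℝ)) →
            ‖covDeriv C (0 : HiggsLattice.VecField P 0)
                (propagatorK C Finset.univ (0 : HiggsLattice.VecField P 0) msq a k g) ⟨x, μ⟩‖
              ≤ c₀ * P.mesh k * Real.exp (-(δ₀ * (D / (P.L : ℝ) ^ k))) * M := by
  obtain ⟨δ₀, c, hδ₀, hc, hG⟩ := torus_deriv_decay_bound d L hd hL ha (show 0 ≤ msq * ε₀ ^ 2 by positivity)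
  have hN0 : 0 ≤ Real.sqrt N := Real.sqrt_nonneg _
  refine ⟨δ₀, (Real.sqrt N + 1) * c, hδ₀, mul_pos (by positivity) hc, ?_⟩
  intro P S hPd hPL C k hk1 hk hε g M D hg hD0 x μ hD
  have hℓ := P.mesh_pos k
  have hM : 0 ≤ M := (norm_nonneg _).trans (hg x)
  have hcap : msq * P.mesh k ^ 2 ≤ msq * ε₀ ^ 2 := mul_le_mul_of_nonneg_left (pow_le_pow_left₀ hℓ.le hε 2) hmsq
  have hDS : ∀ (i : Fin N) (z : Site (setupAt S k) 0), cmpAt S hk i g z ≠ 0 →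
      D ≤ T (setupAt S k) 0 (eSiteAt S hk (Nat.zero_le _) x) z := by
    intro i z hz
    rw [T_eq_tdist_symm S hk (Nat.zero_le _), Equiv.symm_apply_apply]
    refine hD _ fun h0 => hz ?_
    rw [cmpAt_apply, h0]
    rfl
  subst hPd
  have hcomp : ∀ i : Fin N,
      |(covDeriv C (0 : HiggsLattice.VecField P 0)
          (propagatorK C Finset.univ (0 : HiggsLattice.VecField P 0) msq a k g) ⟨x, μ⟩) i|
        ≤ P.mesh k * (c * Real.exp (-(δ₀ * (D / (P.L : ℝ) ^ k))) * M) := by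
    intro i
    rw [covDeriv_zero, sderiv_propagatorK_apply_at S hk C hk1 ha hmsq, abs_mul, abs_of_pos hℓ]
    refine mul_le_mul_of_nonneg_left ?_ hℓ.le
    have h := hG (setupAt S k) rfl hPL hk1 (msq * P.mesh k ^ 2) (mul_nonneg hmsq (sq_nonneg _)) hcap μ
      (eSiteAt S hk (Nat.zero_le _) x) (cmpAt S hk i g) M D (abs_cmpAt_le S hk hg i) hD0 (fun z hz => hDS i z hz)
    rwa [eps_setupAt_mul] at h
  calc ‖covDeriv C (0 : HiggsLattice.VecField P 0)
          (propagatorK C Finset.univ (0 : HiggsLattice.VecField P 0) msq a k g) ⟨x, μ⟩‖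
      ≤ Real.sqrt N * (P.mesh k * (c * Real.exp (-(δ₀ * (D / (P.L : ℝ) ^ k))) * M)) :=
        norm_le_sqrt_mul _ (by positivity) hcomp
    _ ≤ (Real.sqrt N + 1) * (P.mesh k * (c * Real.exp (-(δ₀ * (D / (P.L : ℝ) ^ k))) * M)) :=
        mul_le_mul_of_nonneg_right (by linarith) (by positivity)
    _ = (Real.sqrt N + 1) * c * P.mesh k * Real.exp (-(δ₀ * (D / (P.L : ℝ) ^ k))) * M := by ring

/-- **(2.25), DERIVATIVE CLAUSE, SUP-NORM FORM, EVERY LEVEL** (the case `D = 0`): one `c₀ > 0` with `‖(D^ε_0G^ε_k(T_ε,0)g)(b)‖ ≦ c₀(L^kε)M`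
for every torus of the sub-family, every coupling, every `1 ≦ k ≦ K` with `L^kε ≦ ε₀`, every bond and every `‖g‖ ≦ M`.
[cite: Balaban1982Higgs1, Prop. 2.1 (2.25) p.610] -/
theorem covDeriv_propagatorK_sup_bound (d L N : ℕ) (hd : 1 ≤ d) (hL : Odd L ∧ 1 < L) {a : ℝ} (ha : 0 < a) {msq : ℝ}
    (hmsq : 0 ≤ msq) (ε₀ : ℝ) :
    ∃ c₀ : ℝ, 0 < c₀ ∧ ∀ (P : HiggsLattice.Params) (_S : Shape P), P.d = d → P.L = L →
      ∀ (C : ChargeData N) {k : ℕ}, 1 ≤ k → k ≤ P.K → P.mesh k ≤ ε₀ →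
        ∀ (g : HiggsLattice.ScalarField P 0 N) (M : ℝ), (∀ x, ‖g x‖ ≤ M) → ∀ (b : HiggsLattice.PBond P 0),
          ‖covDeriv C (0 : HiggsLattice.VecField P 0)
              (propagatorK C Finset.univ (0 : HiggsLattice.VecField P 0) msq a k g) b‖ ≤ c₀ * P.mesh k * M := by
  obtain ⟨δ₀, c₀, _, hc₀, h⟩ := covDeriv_propagatorK_decay_bound d L N hd hL ha hmsq ε₀
  refine ⟨c₀, hc₀, fun P S hPd hPL C k hk1 hk hε g M hg b => ?_⟩
  obtain ⟨x, μ⟩ := b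
  have h' := h P S hPd hPL C hk1 hk hε g M 0 hg le_rfl x μ (fun z _ => Nat.cast_nonneg _)
  simpa only [zero_div, mul_zero, neg_zero, Real.exp_zero, mul_one] using h'

end Model

end Literature.MathematicalPhysics.QuantumFieldTheory.Balaban1983to89.B1Ineq225DerivZeroFieldTorus
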